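import Literature.AlgebraicGeometry.KTheory.CoherentGrothendieckGroupRankLocallyFree
import Literature.AlgebraicGeometry.Modules.FlatStalksTensorExact
import Mathlib.RingTheory.Flat.Basic
import HarnessLib

/-!
# Stalks of finite locally free modules are free, hence flat; `E ⊗ –` is exact for a vector bundle `E`, by flatness

Layer `Literature/AlgebraicGeometry/Modules` (0 definitions, 0 named facts, no instances — `Module.Free` / `Module.Flat`
conclusions are stated as theorems —, no notation). Hartshorne II.5 (p. 109) / Ex. 5.7 (a): "if `𝓕` is locally free then
the stalk `𝓕_x` is a free `𝒪_x`-module"; The Stacks Project, Tag 05NE with 00NX (free ⇒ flat):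

* **`free_stalk_of_isFiniteLocallyFree`** — the stalk `E_x` of a finite locally free `𝒪_X`-module is a free
  `𝒪_{X,x}`-module (a frame `𝒪^I_W ≅ E|_W` around `x` gives the basis of germs, the tree's
  `nonempty_basis_stalk_of_frame`);
* **`flat_stalk_of_isFiniteLocallyFree`** — hence flat (Mathlib `Module.Flat.of_free`);
* `preservesFiniteLimits_tensorBifunctor_obj_of_isFiniteLocallyFree'`, `preservesHomology_tensorBifunctor_obj_of_isFiniteLocallyFree'`,
  `shortExact_map_tensorBifunctor_obj_of_isFiniteLocallyFree` — `E ⊗ –` (and `– ⊗ E`) is exact for `E` finite locally free,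
  now as COROLLARIES of the flat-stalk criterion `Modules/FlatStalksTensorExact` (the tree's earlier proofs
  `Modules/BoxTensorExactRight.preservesFiniteLimits_tensorBifunctor_obj_of_isFiniteLocallyFree` ∕
  `KTheory/CoherentGrothendieckGroupModule.shortExact_map_tensorBifunctor_obj` go through `E ⊗ – ≅ 𝓗om(E^∨, –)`; the
  primed names avoid those FQNs).

Everything is proved; no named fact. Library only (cell `pub-hodge-ring2`, count-neutral; proves nothing about any crux,
route or conjecture).

## References

* R. Hartshorne, *Algebraic Geometry*, GTM 52 (1977), II.5 (p. 109), II Ex. 5.7 (a) (p. 124). [Hartshorne1977]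
* The Stacks Project, Tag 05NE (flat modules), Tag 00NX (free ⇒ projective ⇒ flat), Tag 01C6. [StacksProject]
-/

noncomputable section

-- `TopCat.Presheaf`/`Scheme.Modules` are not reducible (as in Mathlib's `AlgebraicGeometry/Modules`).
set_option backward.isDefEq.respectTransparency false

open CategoryTheory CategoryTheory.Limits AlgebraicGeometry TopologicalSpace Opposite

universe u

namespace Literature.AlgebraicGeometry.Modules

open Literature.AlgebraicGeometry.Motives (IsFiniteLocallyFree)

variable {X : Scheme.{u}} {E : X.Modules}

/-- **The stalk of a finite locally free module is free** (Hartshorne II.5: "the stalk `𝓕_x` is a free `𝒪_x`-module"): a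
frame `𝒪^I_W ≅ E|_W` around `x` gives a basis of `E_x` made of the germs of the frame sections.
[cite: Hartshorne1977, II.5 (p. 109) and Ex. 5.7 (a)] [cite: StacksProject, Tag 01C6] -/
theorem free_stalk_of_isFiniteLocallyFree (hE : IsFiniteLocallyFree E) (x : X) :
    Module.Free (X.presheaf.stalk x) (MStalk x E) := by
  obtain ⟨W, hxW, I, hI, ⟨e⟩⟩ := hE x
  haveI : Fintype I := Fintype.ofFinite I
  obtain ⟨b⟩ := nonempty_basis_stalk_of_frame x e hxW
  exact Module.Free.of_basis b

/-- **The stalk of a finite locally free module is flat** (free ⇒ flat). [cite: StacksProject, Tag 00NX]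
[cite: Hartshorne1977, II.5 (p. 109)] -/
theorem flat_stalk_of_isFiniteLocallyFree (hE : IsFiniteLocallyFree E) (x : X) :
    Module.Flat (X.presheaf.stalk x) (MStalk x E) := by
  haveI := free_stalk_of_isFiniteLocallyFree hE x
  infer_instance

/-- **`E ⊗ –` is left exact for `E` finite locally free**, by flatness of the stalks (`Modules/FlatStalksTensorExact`).
[cite: StacksProject, Tag 05NE] [cite: Hartshorne1977, III Prop. 9.2 (context)] -/
theorem preservesFiniteLimits_tensorBifunctor_obj_of_isFiniteLocallyFree' (hE : IsFiniteLocallyFree E) :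
    PreservesFiniteLimits ((tensorBifunctor X).obj E) :=
  preservesFiniteLimits_tensorBifunctor_obj_of_flat E (flat_stalk_of_isFiniteLocallyFree hE)

/-- **`E ⊗ –` is exact (preserves homology) for `E` finite locally free**, by flatness of the stalks.
[cite: StacksProject, Tag 05NE] -/
theorem preservesHomology_tensorBifunctor_obj_of_isFiniteLocallyFree' (hE : IsFiniteLocallyFree E) :
    haveI := additive_tensorBifunctor_obj E
    ((tensorBifunctor X).obj E).PreservesHomology :=
  preservesHomology_tensorBifunctor_obj_of_flat E (flat_stalk_of_isFiniteLocallyFree hE)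

/-- **Short exact sequences stay short exact after `E ⊗ –`** for `E` finite locally free (no hypothesis on the sequence).
[cite: StacksProject, Tag 05NE] -/
theorem shortExact_map_tensorBifunctor_obj_of_isFiniteLocallyFree (hE : IsFiniteLocallyFree E)
    {S : ShortComplex X.Modules} (hS : S.ShortExact) :
    haveI := additive_tensorBifunctor_obj E
    (S.map ((tensorBifunctor X).obj E)).ShortExact :=
  shortExact_map_tensorBifunctor_obj_of_flat E (flat_stalk_of_isFiniteLocallyFree hE) hS

/-- **`– ⊗ E` is exact (preserves homology) for `E` finite locally free.** [cite: StacksProject, Tag 05NE] -/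
theorem preservesHomology_tensorBifunctor_flip_obj_of_isFiniteLocallyFree (hE : IsFiniteLocallyFree E) :
    haveI := additive_tensorBifunctor_flip_obj E
    ((tensorBifunctor X).flip.obj E).PreservesHomology :=
  preservesHomology_tensorBifunctor_flip_obj_of_flat E (flat_stalk_of_isFiniteLocallyFree hE)

end Literature.AlgebraicGeometry.Modules

end
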